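import Summits.ResolutionOfSingularities.ResolutionOfSingularities.Theorems.FrobeniusClosingPatchingRelPerfectDepthOneTowerContractionHolds
import Summits.ResolutionOfSingularities.ResolutionOfSingularities.Theorems.FrobeniusClosingPatchingRelPerfectCoreRungClosure
import Summits.ResolutionOfSingularities.ResolutionOfSingularities.Theorems.FrobeniusClosingPatchingRelPerfectDepthGradedTargets
import Literature.AlgebraicGeometry.Resolution.MonomialMarkedIdealsBlowupGeneral
import Literature.AlgebraicGeometry.Resolution.EmbeddedResolutionExcellentSurfacesSequence
import Literature.AlgebraicGeometry.Resolution.QuasiExcellentSchemes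
import HarnessLib

/-!
# `PatchingRelPerfect` (stmt-ResolutionOfSingularities-16161), chain W5.2 — rung R5ᴴ «hypersurface-led members of every depth»:
# TARGETS (definitions + the PROVED composition)

[OURS · L1 W5.2 · res-D-pv-055 R5ᴴ DESIGN MEMO v1 (cell `D/res-D-pv-055/R5H-DESIGN-MEMO.md` b620d5ca)] A member `I ⊆ S` of the
dimension-four atom is HYPERSURFACE-LED when its blowing up is carried, over `X = Bl_𝔪 Spec S`, by a REGULAR hypersurface `H ⊂ X`
in the format `I𝒪_X = M · (𝓘_H ⊔ 𝓘_E^ℓ)` (one-form members `I = (f) + (x_k^{d+ℓ})_k` whose strict transform `H` of `V(f)` is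
regular along the exceptional divisor `E`; e.g. the regular-form members of every depth and the `A₂` contact-migration members).
The rung closes such members MODULO F-32bR ONLY, by a WEIGHT-ONE tower led by `H` (X-side) and a divisor game on the regular
threefold `H` (E-side, carrier `H` rather than `E`):

* X-side STATE `HLedState S I W X i g ℬ`: `i : W → X` a closed immersion onto the regular Cartier carrier `H = i(W)`, boundary
  `ℬ = [(B_j, a_j)]` of effective Cartier ideals cosupported over the closed point, format `I𝒪_X = M · (𝓘_H ⊔ Π B_j^{a_j})`;
* E-side GAME `HSepSeq ρ 𝒟 𝒟'` on `W`: divisors `D_j := B_j|_W` with exponents; a move blows up a connected regular centre `V(C)`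
  lying on a member of positive exponent; LAW `D_j ↦ τᶜ(D_j, 1)` (the colon by the exceptional ideal, uniformly: it divides
  once exactly for the members through `V(C)`), new member `(C𝒪, w − 1)` with `w` the total exponent through `V(C)`
  (`weightOf 𝒟 (divisorsOver 𝒟 C (supp C))`); this is EXACTLY the restriction to `W' = Bl_C W` of the X-side weight-one step
  `K ↦ σᶜ(K, 1) = 𝓘_{H'} ⊔ Π σᶜ(B_j,1)^{a_j} · (C𝒪)^{w−1}` (pure ideal algebra; no multiplicity, regularity or snc of the `B_j`);
* TARGETS: `HSepGame₃` (E-side, OURS, fact-free statement: every `[(D, ℓ)]`, `D ≠ ⊤` effective Cartier on an integral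
  Noetherian regular excellent threefold, is carried to a state whose positively-charged members are all `⊤` — route N3–N5:
  F-32bR on `(W, Supp D, ∅)` + components regular + peel, memo §2), `HLedStep` / `HLedTower` (X-side, N2), `HLedInitial` (N1:
  the package of a hypersurface-led one-form member `oneFormMemberIdeal`, condition `IsHypersurfaceLed`);
* PROVED here: `HLedState.atomConclusion_of_end` (END: positively-charged members off `H` ⇒ `K = ⊤` ⇒ D5 `towerContraction_holds`
  ⇒ CORE conclusion), `hLedTower_of_step`, **`hLed_atomConclusion_of_targets : HSepGame₃ → HLedTower → every `HLedPackage` member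
  ∈ 𝒞`** and **`hLedMember_atomConclusion_of_targets : HLedInitial → HSepGame₃ → HLedStep → every hypersurface-led one-form
  member of every depth ∈ 𝒞`** (F-32bR enters only through N3's `hSepGame₃_of_cjsB`).

Honest framing: OURS (AI-written, weaker than expert review); definitions and a composition of tree theorems; nothing here is
a statement of the manuscript under review; no fact is asserted or taken as antecedent in this file.

## Sources
* J. Kollár, *Lectures on Resolution of Singularities* (2007), (3.111) Steps 1–3 (monomial bookkeeping, weight-one transforms).
  [Kollar2007]
* E. Bierstone, D. Grigoriev, P. Milman, J. Włodarczyk (2011), §3.2 (controlled transform). [BierstoneGrigorievMilmanWlodarczyk2011]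
* V. Cossart, U. Jannsen, S. Saito, LNM 2270 (2020), Thm. 1.4 (the E-side driver F-32bR). [CossartJannsenSaito2020]
* The Stacks Project, Tag 080A (compositions of blowings up). [StacksProject]
-/

set_option linter.dupNamespace false -- mandated namespace of this single-conjunct summit

noncomputable section

open CategoryTheory CategoryTheory.Limits AlgebraicGeometry TopologicalSpace IsLocalRing
open Literature.AlgebraicGeometry.Resolution Literature.AlgebraicGeometry.Motives Scheme.IdealSheafData

namespace Summit.ResolutionOfSingularities.ResolutionOfSingularities.Theorems.DepthTargets

universe u

/-! ## §1 The X-side state -/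

/-- [OURS · L1 W5.2 · R5ᴴ] **The H-led state.** `S` regular local, `I ⊆ S`; `g : X → Spec S` a blowing up along an ideal sheaf
cosupported in the closed point, `X` Noetherian and regular; `i : W → X` a closed immersion of a REGULAR scheme `W` (the
hypersurface carrier `H = i(W)`) whose ideal `i.ker` is an effective Cartier divisor; a boundary `ℬ` of effective Cartier ideal
sheaves cosupported over the closed point, with exponents; and the FORMAT `I𝒪_X = M · (𝓘_H ⊔ Π_{(B,a) ∈ ℬ} B^a)`, `M` invertible.
(The initial state of a hypersurface-led one-form member of depth `ℓ`: `X = Bl_𝔪 Spec S`, `H` = strict transform of `V(f)`,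
`ℬ = [(𝓘_E, ℓ)]`, `M = 𝓘_E^d`.) (cf. Kollár 2007 = bib Kollar2007, (3.111) Step 3 — OURS node; pointer in prose, the structure
being a hypothesis package) -/
structure HLedState (S : Type u) [CommRing S] [IsRegularLocalRing S] (I : Ideal S) (W X : Scheme.{u}) (i : W ⟶ X)
    (g : X ⟶ Spec (.of S)) (ℬ : List (X.IdealSheafData × ℕ)) : Prop where
  /-- `X` is Noetherian -/
  isNoetherian : IsNoetherian X
  /-- `X` is regular -/
  isRegular : Scheme.IsRegular X
  /-- the carrier `W ≅ H` is regular -/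
  isRegular_host : Scheme.IsRegular W
  /-- `i : W ⟶ X` is a closed immersion … -/
  isClosedImmersion : IsClosedImmersion i
  /-- … whose ideal is an effective Cartier divisor -/
  isEffectiveCartier_ker : IsEffectiveCartier i.ker
  /-- `g` is a blowing up along an ideal sheaf cosupported in the closed point -/
  exists_isBlowup_supported : ∃ K₀ : (Spec (.of S)).IdealSheafData, IsBlowup g K₀ ∧
    (K₀.support : Set (Spec (.of S))) ⊆ {IsLocalRing.closedPoint S}
  /-- the boundary members are effective Cartier divisors … -/
  boundary_cartier : ∀ p ∈ ℬ, IsEffectiveCartier p.1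
  /-- … cosupported over the closed point -/
  boundary_support : ∀ p ∈ ℬ, ∀ x : X, x ∈ (p.1.support : Set X) → g.base x = IsLocalRing.closedPoint S
  /-- the FORMAT `I𝒪_X = M · (𝓘_H ⊔ monomial)` with `M` invertible -/
  exists_format : ∃ M : X.IdealSheafData, IsEffectiveCartier M ∧
    (affineBlowup.idealSheaf I).comap g = M * (i.ker ⊔ monomialIdeal ℬ)

/-- The E-side datum of a state: the boundary restricted to the carrier, `D_j := B_j|_W`, with the same exponents (OURS bookkeeping). [folklore] -/
def restrictBoundary {W X : Scheme.{u}} (i : W ⟶ X) (ℬ : List (X.IdealSheafData × ℕ)) : List (W.IdealSheafData × ℕ) :=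
  ℬ.map fun p => (p.1.comap i, p.2)

/-! ## §2 The E-side game on the carrier -/

/-- [OURS · L1 W5.2 · R5ᴴ] **The H-side separation sequence** `HSepSeq ρ 𝒟 𝒟'`: `ρ : W' → W` is a composition of blowings up in
CONNECTED REGULAR centres `V(C)`, each lying on a member of POSITIVE exponent of the current list
(`1 ≤ weightOf 𝒟' (divisorsOver 𝒟' C (supp C))`, so the X-side ideal `𝓘_H ⊔ monomial` is contained in `C`), the list transported
by the WEIGHT-ONE LAW: every member `D ↦ τᶜ(D, 1) = (τ^*D : C𝒪)` (the members through `V(C)` are divided by the exceptional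
ideal exactly once, the others are pulled back), exponents kept, and the exceptional member `(C𝒪, w − 1)` appended, `w` the total
exponent of the members through `V(C)`. (cf. Kollár 2007 = bib Kollar2007, (3.111) Step 3; BGMW 2011 §3.2 — OURS node; pointer in
prose) -/
inductive HSepSeq : ∀ {W' W : Scheme.{u}}, (W' ⟶ W) → List (W.IdealSheafData × ℕ) → List (W'.IdealSheafData × ℕ) → Prop
  /-- the empty sequence -/
  | nil {W : Scheme.{u}} (𝒟 : List (W.IdealSheafData × ℕ)) : HSepSeq (𝟙 W) 𝒟 𝒟
  /-- one more blowing up in a connected regular centre lying on a positively charged member -/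
  | cons {W'' W' W : Scheme.{u}} (τ : W'' ⟶ W') (ρ : W' ⟶ W) (𝒟 : List (W.IdealSheafData × ℕ))
      (𝒟' : List (W'.IdealSheafData × ℕ)) (C : W'.IdealSheafData) :
      HSepSeq ρ 𝒟 𝒟' →
      Scheme.IsRegular C.subscheme → _root_.IsPreconnected (C.support : Set W') →
      1 ≤ weightOf 𝒟' (divisorsOver 𝒟' C C.support) →
      IsBlowup τ C →
      HSepSeq (τ ≫ ρ) 𝒟
        (𝒟'.map (fun p => (controlledTransform τ C p.1 1, p.2)) ++
          [(C.comap τ, weightOf 𝒟' (divisorsOver 𝒟' C C.support) - 1)])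

/-- [OURS · L1 W5.2 · R5ᴴ] **The END of the game**: every positively-charged member is the unit ideal (its divisor is off the
carrier). (OURS node; folklore bookkeeping) -/
def HSepEnd {W : Scheme.{u}} (𝒟 : List (W.IdealSheafData × ℕ)) : Prop :=
  ∀ p ∈ 𝒟, 1 ≤ p.2 → p.1 = ⊤

/-- [OURS · L1 W5.2 · R5ᴴ] **TARGET (E-side) `HSepGame₃` — the separation game is winnable on regular excellent threefolds**
(OURS statement, NO fact inside; its discharge `hSepGame₃_of_cjsB` from F-32bR is N3): for `W` integral Noetherian regular
excellent of dimension three, every effective Cartier `D ≠ ⊤` and `ℓ ≥ 1`, some `HSepSeq` from `[(D, ℓ)]` reaches `HSepEnd`.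
Route (memo §2): CJS VERBATIM on `(W, Supp D, ∅)`
transported as `HSepSeq` moves (pieces loop; every CJS centre lies in the strict transform `⊆ Supp` of the charged member), then
every component of the end supports is regular (divisorial points: a component of the regular strict transform or of the snc
boundary), then PEEL the components one at a time (`μ = Σ a_j · mult` drops by one per peel).
(cf. Cossart–Jannsen–Saito 2020 = bib CossartJannsenSaito2020, Thm. 1.4; Kollár 2007, (3.111) Step 3 — OURS node; pointer in prose,
the Prop being parameterless) -/
def HSepGame₃ : Prop :=
  ∀ (W : Scheme.{u}) [IsIntegral W] [IsNoetherian W], Scheme.IsRegular W → Scheme.IsExcellent W →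
    topologicalKrullDim W = 3 → ∀ (D : W.IdealSheafData), IsEffectiveCartier D → D ≠ ⊤ → ∀ ℓ : ℕ, 1 ≤ ℓ →
      ∃ (W' : Scheme.{u}) (ρ : W' ⟶ W) (𝒟' : List (W'.IdealSheafData × ℕ)), HSepSeq ρ [(D, ℓ)] 𝒟' ∧ HSepEnd 𝒟'

/-! ## §3 The X-side targets: one step, and the tower -/

/-- [OURS · L1 W5.2 · R5ᴴ] **TARGET (X-side) `HLedStep` — ONE weight-one H-led step**: a move of the game on the carrier of a
state (connected regular centre `V(C) ⊆ W` on a positively charged member, `τ : W' → W` its blowing up) is realised by the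
blowing up `σ` of `X` along `i(V(C))` (over the closed point), with the state re-established on `W'` — the strict transform of
the carrier — and the transported boundary `ℬ' := [σᶜ(B,1)]_{B ∈ ℬ} ++ [(exceptional, w − 1)]`, whose restriction to `W'` IS the
E-side law. Route (memo §1): `σᶜ(𝓘_H ⊔ Π B^a, 1) = 𝓘_{H'} ⊔ Π σᶜ(B,1)^a · (C𝒪)^{w−1}` (`J ≤ C𝒪` invertible ⇒ `J = C𝒪 · (J : C𝒪)`;
`σ^*𝓘_H = C𝒪 · 𝓘_{H'}` as `H ⊇ V(C)` is regular), `H' = Bl_C H` regular, `M' = σ^*M · C𝒪`, restriction along the cartesian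
square `W' → X'` / `W → X` (`comap_controlledTransform_of_isEffectiveCartier` pattern). (cf. Kollár 2007 = bib Kollar2007,
(3.111) Step 3; BGMW 2011 Lemma 3.2.1 — OURS node; pointer in prose, the Prop being parameterless) -/
def HLedStep : Prop :=
  ∀ (S : Type u) [CommRing S] [IsRegularLocalRing S] (I : Ideal S) (W X : Scheme.{u}) (i : W ⟶ X)
    (g : X ⟶ Spec (.of S)) (ℬ : List (X.IdealSheafData × ℕ)),
    HLedState S I W X i g ℬ →
    ∀ (W' : Scheme.{u}) (τ : W' ⟶ W) (C : W.IdealSheafData),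
      Scheme.IsRegular C.subscheme → _root_.IsPreconnected (C.support : Set W) →
      1 ≤ weightOf (restrictBoundary i ℬ) (divisorsOver (restrictBoundary i ℬ) C C.support) →
      IsBlowup τ C →
        ∃ (X' : Scheme.{u}) (σ : X' ⟶ X) (i' : W' ⟶ X') (ℬ' : List (X'.IdealSheafData × ℕ)),
          i' ≫ σ = τ ≫ i ∧ IsBlowup σ (C.map i) ∧ HLedState S I W' X' i' (σ ≫ g) ℬ' ∧
          restrictBoundary i' ℬ' =
            (restrictBoundary i ℬ).map (fun p => (controlledTransform τ C p.1 1, p.2)) ++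
              [(C.comap τ, weightOf (restrictBoundary i ℬ) (divisorsOver (restrictBoundary i ℬ) C C.support) - 1)]


/-- [OURS · L1 W5.2 · R5ᴴ] **TARGET (X-side) `HLedTower` — the weight-one H-led tower**: every `HSepSeq` on the carrier of a state
is realised by blowings up of `X` in the images of its centres (over the closed point: they lie on boundary members), the state
re-established on the strict transform of the carrier with the transported boundary, whose restriction IS the E-side list.
Route (memo §1): one step = `σᶜ(𝓘_H ⊔ Π B^a, 1) = 𝓘_{H'} ⊔ Π σᶜ(B,1)^a · (C𝒪)^{w−1}` (`J ≤ C𝒪` invertible ⇒ `J = C𝒪 · (J : C𝒪)`),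
`H' = Bl_C H` regular, `M' = σ^*M · C𝒪`, blow-ups compose (080A); induction on `HSepSeq`.
(cf. Kollár 2007 = bib Kollar2007, (3.111) Step 3; Stacks 080A — OURS node; pointer in prose, the Prop being parameterless) -/
def HLedTower : Prop :=
  ∀ (S : Type u) [CommRing S] [IsRegularLocalRing S] (I : Ideal S) (W X : Scheme.{u}) (i : W ⟶ X)
    (g : X ⟶ Spec (.of S)) (ℬ : List (X.IdealSheafData × ℕ)),
    HLedState S I W X i g ℬ →
    ∀ (W' : Scheme.{u}) (ρ : W' ⟶ W) (𝒟' : List (W'.IdealSheafData × ℕ)),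
      HSepSeq ρ (restrictBoundary i ℬ) 𝒟' →
        ∃ (X' : Scheme.{u}) (π : X' ⟶ X) (i' : W' ⟶ X') (ℬ' : List (X'.IdealSheafData × ℕ)),
          i' ≫ π = ρ ≫ i ∧ HLedState S I W' X' i' (π ≫ g) ℬ' ∧ restrictBoundary i' ℬ' = 𝒟'

/-- **The tower from the step** (PROVED): induction on the game, the X-side data generalised. [cite: StacksProject, Tag 080A] -/
theorem hLedTower_of_step (hstep : HLedStep.{u}) : HLedTower.{u} := by
  intro S _ _ I W X i g ℬ hst W' ρ 𝒟' hseq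
  generalize h𝒟 : restrictBoundary i ℬ = 𝒟 at hseq
  induction hseq generalizing X with
  | nil 𝒟 =>
    exact ⟨X, 𝟙 X, i, ℬ, by rw [Category.comp_id, Category.id_comp], by rwa [Category.id_comp], h𝒟⟩
  | cons τ ρ 𝒟 𝒟₁ C _ hC hconn hw hτ ih =>
    obtain ⟨X₁, π₁, i₁, ℬ₁, hcomm₁, hst₁, hres₁⟩ := ih X i g ℬ hst h𝒟
    subst hres₁
    obtain ⟨X₂, σ, i₂, ℬ₂, hcomm₂, -, hst₂, hres₂⟩ := hstep S I _ X₁ i₁ (π₁ ≫ g) ℬ₁ hst₁ _ τ C hC hconn hw hτ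
    refine ⟨X₂, σ ≫ π₁, i₂, ℬ₂, ?_, by rwa [Category.assoc], hres₂⟩
    rw [← Category.assoc, hcomm₂, Category.assoc, hcomm₁, Category.assoc]

/-! ## §4 Members: the package, and the PROVED composition -/

/-- [OURS · L1 W5.2 · R5ᴴ] **A hypersurface-led package for the member `I`**: an H-led state with ONE boundary member of exponent
`ℓ ≥ 1` (the exceptional divisor) whose carrier `W` is an integral Noetherian regular excellent threefold met by that member in an
effective Cartier divisor `≠ ⊤`. (Instances — one-form members whose strict transform is regular along `E` — are separate
theorems.) (cf. Kollár 2007 = bib Kollar2007, (3.111) Step 3 — OURS node; pointer in prose) -/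
def HLedPackage (S : Type u) [CommRing S] [IsRegularLocalRing S] (I : Ideal S) : Prop :=
  ∃ (W X : Scheme.{u}) (i : W ⟶ X) (g : X ⟶ Spec (.of S)) (B₀ : X.IdealSheafData) (ℓ : ℕ),
    1 ≤ ℓ ∧ HLedState S I W X i g [(B₀, ℓ)] ∧ IsIntegral W ∧ IsNoetherian W ∧ Scheme.IsExcellent W ∧
      topologicalKrullDim W = 3 ∧ IsEffectiveCartier (B₀.comap i) ∧ B₀.comap i ≠ ⊤

namespace HLedState

variable {S : Type u} [CommRing S] [IsRegularLocalRing S] {I : Ideal S} {W X : Scheme.{u}} {i : W ⟶ X}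
  {g : X ⟶ Spec (.of S)} {ℬ : List (X.IdealSheafData × ℕ)}

/-- A member off the carrier: `B|_W = ⊤` forces `𝓘_H ⊔ B = ⊤`. [folklore] -/
theorem ker_sup_eq_top_of_comap_eq_top (h : HLedState S I W X i g ℬ) {B : X.IdealSheafData} (hB : B.comap i = ⊤) :
    i.ker ⊔ B = ⊤ := by
  haveI := h.isClosedImmersion
  rw [← support_eq_bot_iff, support_sup, eq_bot_iff]
  intro x hx
  have hxk : x ∈ (i.ker.support : Set X) := hx.1
  rw [Scheme.Hom.support_ker, i.isClosedEmbedding.isClosed_range.closure_eq] at hxk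
  obtain ⟨w, rfl⟩ := hxk
  have hw : w ∈ ((B.comap i).support : Set W) := by
    rw [support_comap]; exact hx.2
  rw [hB, support_top] at hw
  exact hw

/-- At the END of the game the X-side ideal is the unit ideal: `𝓘_H ⊔ Π B^a = ⊤` when every positively-charged member is off the
carrier. [folklore] -/
theorem ker_sup_monomialIdeal_eq_top (h : HLedState S I W X i g ℬ) (hend : HSepEnd (restrictBoundary i ℬ)) :
    i.ker ⊔ monomialIdeal ℬ = ⊤ := by
  haveI := h.isClosedImmersion
  rw [← support_eq_bot_iff, support_sup, eq_bot_iff]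
  rintro x ⟨hxk, hxm⟩
  -- a point of `cosupp (monomial)` lies on some member of positive exponent
  have key : ∀ (L : List (X.IdealSheafData × ℕ)), (∀ p ∈ L, 1 ≤ p.2 → i.ker ⊔ p.1 = ⊤) →
      x ∈ ((monomialIdeal L).support : Set X) → False := by
    intro L
    induction L with
    | nil =>
      intro _ hx
      rw [monomialIdeal_nil, support_top] at hx
      exact hx
    | cons p L ih =>
      intro hL hx
      rw [monomialIdeal_cons, support_mul] at hx
      rcases hx with hx | hx
      · rcases Nat.eq_zero_or_pos p.2 with h0 | hpos
        · rw [h0, pow_zero, Scheme.IdealSheafData.one_eq_top, support_top] at hx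
          exact hx
        · rw [support_pow p.1 p.2 hpos.ne'] at hx
          have htop := hL p (by simp) hpos
          rw [← support_eq_bot_iff, support_sup, eq_bot_iff] at htop
          exact htop ⟨hxk, hx⟩
      · exact ih (fun q hq => hL q (by simp [hq])) hx
  exact key ℬ (fun p hp hp2 => h.ker_sup_eq_top_of_comap_eq_top (hend (p.1.comap i, p.2)
    (by unfold restrictBoundary; exact List.mem_map.mpr ⟨p, hp, rfl⟩) hp2)) hxm

/-- **END ⇒ the conclusion of the CORE.** At a state whose positively-charged members are off the carrier, `I𝒪_X = M` is
invertible on the regular blowing up `X → Spec S` (cosupported in the closed point); D5 `towerContraction_holds` gives the companion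
and `atomConclusion_of_companion'` the conclusion for every `T = Bl_I Spec S`. [cite: StacksProject, Tag 080A] -/
theorem atomConclusion_of_end (h : HLedState S I W X i g ℬ) (hI : I ≠ ⊥) (hend : HSepEnd (restrictBoundary i ℬ))
    (T : Scheme.{u}) (f : T ⟶ Spec (.of S)) (hf : IsBlowup f (affineBlowup.idealSheaf I)) :
    ∃ (J : T.IdealSheafData) (T' : Scheme.{u}) (π : T' ⟶ T), J ≠ ⊥ ∧
      (∀ t : T, t ∈ J.support → f.base t = IsLocalRing.closedPoint S) ∧
      IsBlowup π J ∧ Scheme.IsRegular T' := by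
  obtain ⟨K₀, hg, hK₀⟩ := h.exists_isBlowup_supported
  obtain ⟨M, hM, hfmt⟩ := h.exists_format
  rw [h.ker_sup_monomialIdeal_eq_top hend, Scheme.IdealSheafData.mul_top] at hfmt
  have hlp : IsLocallyPrincipal ((affineBlowup.idealSheaf I).comap g) := hfmt ▸ hM.isLocallyPrincipal
  exact atomConclusion_of_companion' hI
    (DepthOneTargets.towerContraction_holds S I hI X g K₀ hg hK₀ h.isRegular hlp) T f hf

end HLedState

/-- [OURS · L1 W5.2 · R5ᴴ] **THE RUNG, modulo its two targets: every member with a hypersurface-led package satisfies the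
conclusion of the CORE** (`HSepGame₃` E-side ∘ `HLedTower` X-side ∘ END; fact-free as a composition — F-32bR enters only
through N3's `hSepGame₃_of_cjsB`). [cite: Kollar2007, (3.111) Step 3] -/
theorem hLed_atomConclusion_of_targets (hsep : HSepGame₃.{u}) (htower : HLedTower.{u})
    (S : Type u) [CommRing S] [IsRegularLocalRing S] (I : Ideal S) (hI : I ≠ ⊥) (hpkg : HLedPackage S I)
    (T : Scheme.{u}) (f : T ⟶ Spec (.of S)) (hf : IsBlowup f (affineBlowup.idealSheaf I)) :
    ∃ (J : T.IdealSheafData) (T' : Scheme.{u}) (π : T' ⟶ T), J ≠ ⊥ ∧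
      (∀ t : T, t ∈ J.support → f.base t = IsLocalRing.closedPoint S) ∧
      IsBlowup π J ∧ Scheme.IsRegular T' := by
  obtain ⟨W, X, i, g, B₀, ℓ, hℓ, hst, hint, hnoeth, hexc, hdim, hcart, hne⟩ := hpkg
  -- E-side: win the game from `[(B₀|_W, ℓ)]`
  obtain ⟨W', ρ, 𝒟', hseq, hend⟩ := hsep W hst.isRegular_host hexc hdim (B₀.comap i) hcart hne ℓ hℓ
  -- X-side: realise it
  obtain ⟨X', π, i', ℬ', -, hst', hres⟩ := htower S I W X i g [(B₀, ℓ)] hst W' ρ 𝒟' hseq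
  -- END
  exact hst'.atomConclusion_of_end hI (hres ▸ hend) T f hf

/-! ## §5 The member class: hypersurface-led ONE-FORM members of depth `ℓ`, and the initial-package target -/

/-- [OURS · L1 W5.2 · R5ᴴ] **The one-form member ideal of depth `ℓ`**: `I = (σP₀(x) + σP₁(x) + G) + (x₀^{d+ℓ}, …, x₃^{d+ℓ})` for a
coefficient field `σ`, generators `x`, forms `P₀` (degree `d`), `P₁` (degree `d + 1`) and a remainder `G` (in `𝔪^{d+2}` where
used) — F6's member shape (`oneFormMember_atomConclusion_of_drivers`, `ℓ = 2`) at every depth. (OURS node; pointer in prose: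
Hironaka 2005 = bib Hironaka2005, Lemma 10.3 for the role of such members.) -/
def oneFormMemberIdeal {S : Type u} [CommRing S] {κ₀ : Type u} [Field κ₀] (σ : κ₀ →+* S) (x : Fin (3 + 1) → S) (d ℓ : ℕ)
    (P₀ P₁ : Fin 1 → MvPolynomial (Fin (3 + 1)) κ₀) (G : Fin 1 → S) : Ideal S :=
  Ideal.span (Set.range fun l => MvPolynomial.eval₂Hom σ x (P₀ l) + MvPolynomial.eval₂Hom σ x (P₁ l) + G l) ⊔
    Ideal.span (Set.range fun k => x k ^ (d + ℓ))

/-- [OURS · L1 W5.2 · R5ᴴ] **The hypersurface-led condition on the two leading forms** (closed-point Taylor criterion for the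
strict transform `H` of `V(f)` on `Bl_𝔪 Spec S` to be regular along `E ∩ H = V₊(P₀)`: at `e ∈ ℙ³`, `h = P₀ + t P₁ + t²(…)` is a
regular parameter iff `ord_e 𝓟(P₀) ≤ 1` or `P₁(e) ≠ 0`; by properness over the local base every point of `H` specialises into
`E`, so this is regularity of `H` everywhere — planner G10-2 (e)). (OURS node; pointer in prose.) -/
def IsHypersurfaceLed (κ₀ : Type u) [Field κ₀] (d : ℕ) (P₀ P₁ : Fin 1 → MvPolynomial (Fin (3 + 1)) κ₀)
    (hP₀ : ∀ l, P₀ l ∈ MvPolynomial.homogeneousSubmodule (Fin (3 + 1)) κ₀ d)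
    (hP₁ : ∀ l, P₁ l ∈ MvPolynomial.homogeneousSubmodule (Fin (3 + 1)) κ₀ (d + 1)) : Prop :=
  ∀ e : ProjSpace.P 3 κ₀,
    idealOrder (formsIdealSheaf κ₀ 3 d P₀ hP₀) e ≤ 1 ∨ idealOrder (formsIdealSheaf κ₀ 3 (d + 1) P₁ hP₁) e = 0

/-- [OURS · L1 W5.2 · R5ᴴ] **TARGET `HLedInitial` — the initial hypersurface-led package (N1)**: for `S` COMPLETE regular
local of dimension four with a coefficient field (completeness ⇒ excellence of the carrier, `isExcellentRing_of_isAdicComplete`), a one-form member of depth `ℓ ≥ 1` with `P₀ ≠ 0`, `G ∈ 𝔪^{d+2}`, `(f)` prime and the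
hypersurface-led condition, the member ideal has an `HLedPackage`: `X = Bl_𝔪 Spec S`, `W` = the strict transform of `V(f)`
(integral, Noetherian, regular, excellent, dimension three), `ℬ = [(𝓘_E, ℓ)]`, `M = 𝓘_E^d` (FORMAT `(f)𝒪_X = 𝓘_E^d · 𝓘_H`,
`I𝒪_X = 𝓘_E^d (𝓘_H ⊔ 𝓘_E^ℓ)` — the F6 §1 INITIAL tools `exists_taylor_presentation` / `taylorPackageTwo` patterns).
(OURS node; pointer in prose: Kollár 2007, (3.111) Step 3.) -/
def HLedInitial : Prop :=
  ∀ (S : Type u) [CommRing S] [IsRegularLocalRing S] [IsAdicComplete (IsLocalRing.maximalIdeal S) S],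
    ringKrullDim S = (3 + 1 : ℕ) →
  ∀ (κ₀ : Type u) [Field κ₀] (σ : κ₀ →+* S), Function.Bijective ⇑((IsLocalRing.residue S).comp σ) →
  ∀ (x : Fin (3 + 1) → S), Ideal.span (Set.range x) = IsLocalRing.maximalIdeal S →
  ∀ (d ℓ : ℕ) (P₀ : Fin 1 → MvPolynomial (Fin (3 + 1)) κ₀)
    (hP₀ : ∀ l, P₀ l ∈ MvPolynomial.homogeneousSubmodule (Fin (3 + 1)) κ₀ d)
    (P₁ : Fin 1 → MvPolynomial (Fin (3 + 1)) κ₀)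
    (hP₁ : ∀ l, P₁ l ∈ MvPolynomial.homogeneousSubmodule (Fin (3 + 1)) κ₀ (d + 1))
    (G : Fin 1 → S), (∀ l, G l ∈ IsLocalRing.maximalIdeal S ^ (d + 2)) → P₀ 0 ≠ 0 → 1 ≤ d → 1 ≤ ℓ →
    (Ideal.span {MvPolynomial.eval₂Hom σ x (P₀ 0) + MvPolynomial.eval₂Hom σ x (P₁ 0) + G 0}).IsPrime →
    IsHypersurfaceLed κ₀ d P₀ P₁ hP₀ hP₁ →
      HLedPackage S (oneFormMemberIdeal σ x d ℓ P₀ P₁ G)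

/-- [OURS · L1 W5.2 · R5ᴴ] **THE RUNG for the member class, modulo the three targets `HLedInitial` (N1), `HSepGame₃` (N3–N5),
`HLedStep` (N2)**: every hypersurface-led one-form member of every depth `ℓ ≥ 1` of a four-dimensional regular local ring with a
coefficient field satisfies the conclusion of the CORE — for every blowing up `T = Bl_I Spec S` there is a further blowing up
`T' → T` along a non-zero ideal cosupported over the closed point with `T'` regular. [cite: Kollar2007, (3.111) Step 3] -/
theorem hLedMember_atomConclusion_of_targets (hinit : HLedInitial.{u}) (hsep : HSepGame₃.{u}) (hstep : HLedStep.{u})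
    (S : Type u) [CommRing S] [IsRegularLocalRing S] [IsAdicComplete (IsLocalRing.maximalIdeal S) S]
    (hdim : ringKrullDim S = (3 + 1 : ℕ))
    (κ₀ : Type u) [Field κ₀] (σ : κ₀ →+* S) (hσ : Function.Bijective ⇑((IsLocalRing.residue S).comp σ))
    (x : Fin (3 + 1) → S) (hx : Ideal.span (Set.range x) = IsLocalRing.maximalIdeal S)
    (d ℓ : ℕ) (P₀ : Fin 1 → MvPolynomial (Fin (3 + 1)) κ₀)
    (hP₀ : ∀ l, P₀ l ∈ MvPolynomial.homogeneousSubmodule (Fin (3 + 1)) κ₀ d)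
    (P₁ : Fin 1 → MvPolynomial (Fin (3 + 1)) κ₀)
    (hP₁ : ∀ l, P₁ l ∈ MvPolynomial.homogeneousSubmodule (Fin (3 + 1)) κ₀ (d + 1))
    (G : Fin 1 → S) (hG : ∀ l, G l ∈ IsLocalRing.maximalIdeal S ^ (d + 2)) (hP00 : P₀ 0 ≠ 0) (hd : 1 ≤ d) (hℓ : 1 ≤ ℓ)
    (hprime : (Ideal.span {MvPolynomial.eval₂Hom σ x (P₀ 0) + MvPolynomial.eval₂Hom σ x (P₁ 0) + G 0}).IsPrime)
    (hled : IsHypersurfaceLed κ₀ d P₀ P₁ hP₀ hP₁)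
    (hI : oneFormMemberIdeal σ x d ℓ P₀ P₁ G ≠ ⊥)
    (T : Scheme.{u}) (f : T ⟶ Spec (.of S)) (hf : IsBlowup f (affineBlowup.idealSheaf (oneFormMemberIdeal σ x d ℓ P₀ P₁ G))) :
    ∃ (J : T.IdealSheafData) (T' : Scheme.{u}) (π : T' ⟶ T), J ≠ ⊥ ∧
      (∀ t : T, t ∈ J.support → f.base t = IsLocalRing.closedPoint S) ∧
      IsBlowup π J ∧ Scheme.IsRegular T' :=
  hLed_atomConclusion_of_targets hsep (hLedTower_of_step hstep) S _ hI
    (hinit S hdim κ₀ σ hσ x hx d ℓ P₀ hP₀ P₁ hP₁ G hG hP00 hd hℓ hprime hled) T f hf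

end Summit.ResolutionOfSingularities.ResolutionOfSingularities.Theorems.DepthTargets

end
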